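import Summits.ResolutionOfSingularities.ResolutionOfSingularities.Theorems.ConeCutLaws
import HarnessLib

/-!
# MaxContactCutConeCut — tree file 10/11 (Theses cone): §D the proximity-letter split of aside 31770 — restated HOME pieces
(lens-5 joint residual ≡ repeat half IN KERNEL), the high-plateau pieces, THE ONE CERTIFIED EQUIV
`defectWalksDeep_iff_…`, the decided
sub-cells BY NAME (LAW B / binary / cone-line), necessity kernels by letter.  PROVED.

Content VERBATIM from the decomp-res lens-3 g15 file `HOME/decomp-res-lens-3/g15/parts/ConeCut-rev5-f76e5309.lean`
(sha256 f76e53096babc227…; CRITIC-LEDGER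
rows 102/105/110/123 CLEARED, landing orders 15:53:15Z / 17:40:15Z).  HOME = run/shared/lean/pub/decomp-res.  Host:
route `MaxContactCut`, aside
31770 `DefectWalksDeep` (and 31870) through the tree's lens-3 g14 `Theorems/FloorCut{Classes,Floor}` + `MaxContactCutFloorCut`.

[WRITER NOTE (decomp-res writer g6): per the lens's own landing instruction its §0 (l.130–876 = g14 `FloorCut`
VERBATIM) is DELETED and the
tree's `…Theorems.FloorCut` opened instead; §C⁵ `section AxisLaw` (l.2949–3086) is the tree's
`Theorems/ConeCutAxisLaw` (landed earlier,
opened here); the restated ProximityCut letters `LeavesNewest` / `StaysOnNewest` / `leavesNewest_iff_not_stays` /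
`NoFreePointTailsDeep`
(byte-identical to `Theorems/ProximityCutClasses`) are deleted and opened from the tree; the three class definitions
`IsTameFrom`,
`NoMixedTailsDeep`, `NoTameMixedTailsDeep` live in the cone-free `Theorems/ConeCutClasses` (so the route can import
the co-owned MIXED
aside).  Split: ConeCutClasses · ConeCutLayers / ConeCutLayersPoint (§A state level) · ConeCutWalks (§B) ·
ConeCutLawB (§C) · ConeCutRepeats
(§B⁺, §B⁺⁺⁺ part 1) · ConeCutLawE (§B⁺⁺⁺ part 2, LAW E) · ConeCutZigzag (§B⁺⁺
Fibonacci/zigzag, LAW C) · ConeCutLaws (all-repeat rigidity,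
LAW I, §D booking) · MaxContactCutConeCut / MaxContactCutConeCutCells (§D wiring to 31770/31870 BY NAME, Theses
cone).  ONE namespace
`…Theorems.ConeCut` as in the lens; global `set_option` lines dropped; nothing else changed.]
(Sources: Hauser2010 §§D,F,G; HauserPerlega2019; Moh1987; CossartPiltant2019; CossartJannsenSaito2020 Thm. 2.14,
§§5,9; BenitoVillamayor2013 §7; CasasAlvero2000 Ch. 3; BierstoneGrigorievMilmanWlodarczyk2011 Def. 3.1.3.)
-/

noncomputable section

open MvPolynomial Finset
open Literature.AlgebraicGeometry.Resolution
open Literature.AlgebraicGeometry.Resolution.Hauser2010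
open Literature.AlgebraicGeometry.Resolution.PointBlowup
open Summit.ResolutionOfSingularities.ResolutionOfSingularities.Theorems.TightDefectClasses
open Summit.ResolutionOfSingularities.ResolutionOfSingularities.Theorems.TightDefectStrongWalks
open Summit.ResolutionOfSingularities.ResolutionOfSingularities.Theorems.ItineraryCutClasses
open Summit.ResolutionOfSingularities.ResolutionOfSingularities.Theorems.BoundaryLedger
open Literature.AlgebraicGeometry.Resolution.WeightedBlowup
open Literature.Barriers.ResolutionOfSingularities
open Summit.ResolutionOfSingularities.ResolutionOfSingularities.Theorems.FloorCut
open Summit.ResolutionOfSingularities.ResolutionOfSingularities.Theorems.ConeCutAxisLaw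
open Summit.ResolutionOfSingularities.ResolutionOfSingularities.Theorems.ProximityCut (NoOriginTails LeavesNewest StaysOnNewest)
open Summit.ResolutionOfSingularities.ResolutionOfSingularities.Theorems.ProximityCut (leavesNewest_iff_not_stays NoFreePointTailsDeep)
open Summit.ResolutionOfSingularities.ResolutionOfSingularities.Theorems.ExitLaw (fin3_cases)

namespace Summit.ResolutionOfSingularities.ResolutionOfSingularities.Theorems.ConeCut

/-! ### §D.1 Restated HOME pieces (VERBATIM) -/

/-- PIECE · lens-5 g15's JOINT LOCATED RESIDUAL — VERBATIM `ExitLaw.NoRepeatTranslationRecurrentExcessPlateauxDeep`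
:818 (co-booked residual of 31770; here shown IDENTICAL IN KERNEL to the repeat half of the target,
`joint_iff_repeatHigh`). -/
def NoRepeatTranslationRecurrentExcessPlateauxDeep : Prop :=
  ∀ p : ℕ, p.Prime → ∀ e : ℕ, 2 ≤ e → ∀ (K : Type) [Field K] [CharP K p] [PerfectField K] [DecidableEq K]
    (s₀ : State (Fin 3) K), IsRoot (p ^ e) s₀ → ∀ W : ForcedWalk (p ^ e) s₀, (∀ i, 1 ≤ (W.st i).shade) →
    ∀ N : ℕ, (∀ t, N ≤ t → (W.st (t + 1)).shade = (W.st t).shade) →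
    (∀ t, N ≤ t → ordZero (W.st t).F ≠ ((p ^ e : ℕ) : ℕ∞)) → (∀ M : ℕ, ∃ t, M ≤ t ∧ StaysOnNewest W t) →
    (∀ M : ℕ, ∃ t, M ≤ t ∧ W.b t ≠ 0) → False

/-! ### §D.2 The proximity-letter split of the target (EXACT) -/

/-- PIECE · THE FREE HALF of the target: high subcritical plateaux (`2 ≤ s ≤ q−1`, `o_t > q`, translations i.o.) that
are EVENTUALLY NEWEST-FREE (every late move leaves the component just created).  WEAKER by letter
(`freeHigh_of_highTwo`); DECIDED-MOD-PORT ⟸ arc law (`freeHigh_of_freeTails`; CONVERGENT with lens-5 g15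
`noExcess_of_freeTails_repeat`); PROFILE = rigid high floors (`freeHigh_iff_rigid`, LAW B). -/
def NoFreeHighPlateauxDeepTwo : Prop :=
  ∀ p : ℕ, p.Prime → ∀ e : ℕ, 2 ≤ e → ∀ (K : Type) [Field K] [CharP K p] [PerfectField K] [DecidableEq K]
    (s₀ : State (Fin 3) K), IsRoot (p ^ e) s₀ → ∀ W : ForcedWalk (p ^ e) s₀,
    ∀ N s : ℕ, 2 ≤ s → s < p ^ e →
    (∀ t, N ≤ t → (W.st t).shade = (s : ℕ∞) ∧ ((p ^ e : ℕ) : ℕ∞) < ordZero (W.st t).F) →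
    (∀ M : ℕ, ∃ i, M ≤ i ∧ W.b i ≠ 0) → (∃ M : ℕ, ∀ t, M ≤ t → LeavesNewest W t) → False

/-- PIECE · THE REPEAT HALF of the target: the same plateaux with PROXIMITY REPEATS infinitely often.  WEAKER by letter
(`repeatHigh_of_highTwo`); IDENTICAL IN KERNEL to lens-5 g15's joint residual (`joint_iff_repeatHigh`); translated by
the power law into the cone-line residual (`repeatHigh_iff_coneLine`). -/
def NoRepeatHighPlateauxDeepTwo : Prop :=
  ∀ p : ℕ, p.Prime → ∀ e : ℕ, 2 ≤ e → ∀ (K : Type) [Field K] [CharP K p] [PerfectField K] [DecidableEq K]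
    (s₀ : State (Fin 3) K), IsRoot (p ^ e) s₀ → ∀ W : ForcedWalk (p ^ e) s₀,
    ∀ N s : ℕ, 2 ≤ s → s < p ^ e →
    (∀ t, N ≤ t → (W.st t).shade = (s : ℕ∞) ∧ ((p ^ e : ℕ) : ℕ∞) < ordZero (W.st t).F) →
    (∀ M : ℕ, ∃ i, M ≤ i ∧ W.b i ≠ 0) → (∀ M : ℕ, ∃ t, M ≤ t ∧ StaysOnNewest W t) → False

/-- Necessity of the free half (by letter). [folklore] -/
theorem freeHigh_of_highTwo (h : NoHighPlateauxDeepTwo) : NoFreeHighPlateauxDeepTwo :=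
  fun p hp e he K _ _ _ _ s₀ hs W N s h2 hsq hplat htr _ => h p hp e he K s₀ hs W N s h2 hsq hplat htr

/-- Necessity of the repeat half (by letter). [folklore] -/
theorem repeatHigh_of_highTwo (h : NoHighPlateauxDeepTwo) : NoRepeatHighPlateauxDeepTwo :=
  fun p hp e he K _ _ _ _ s₀ hs W N s h2 hsq hplat htr _ => h p hp e he K s₀ hs W N s h2 hsq hplat htr

/-- **THE PROXIMITY-LETTER SPLIT (PROVED, EXACT)**: a tail is eventually newest-free or has repeats i.o. [folklore] -/
theorem highTwo_iff_free_repeat :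
    NoHighPlateauxDeepTwo ↔ NoFreeHighPlateauxDeepTwo ∧ NoRepeatHighPlateauxDeepTwo := by
  refine ⟨fun h => ⟨freeHigh_of_highTwo h, repeatHigh_of_highTwo h⟩, ?_⟩
  rintro ⟨hF, hR⟩ p hp e he K _ _ _ _ s₀ hs W N s h2 hsq hplat htr
  by_cases hfree : ∃ M : ℕ, ∀ t, M ≤ t → LeavesNewest W t
  · exact hF p hp e he K s₀ hs W N s h2 hsq hplat htr hfree
  · push Not at hfree
    refine hR p hp e he K s₀ hs W N s h2 hsq hplat htr fun M => ?_
    obtain ⟨t, ht, hnot⟩ := hfree M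
    exact ⟨t, ht, not_not.mp ((not_congr (leavesNewest_iff_not_stays W t)).mp hnot)⟩

/-! ### §D.3 The free half: LAW B decides the drifting sub-cell; the residue is RIGID HIGH FLOORS -/

/-- PIECE · DRIFTING free high plateaux — eventually newest-free high plateaux (translations i.o.) that are NOT
eventually a rigid high floor.  WEAKER by letter (`drifting_of_freeHigh`); **DECIDED: EMPTY** (`noDriftingFreeHigh_holds`,
LAW B). -/
def NoDriftingFreeHighPlateauxDeep : Prop :=
  ∀ p : ℕ, p.Prime → ∀ e : ℕ, 2 ≤ e → ∀ (K : Type) [Field K] [CharP K p] [PerfectField K] [DecidableEq K]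
    (s₀ : State (Fin 3) K), IsRoot (p ^ e) s₀ → ∀ W : ForcedWalk (p ^ e) s₀,
    ∀ N s : ℕ, 2 ≤ s → s < p ^ e →
    (∀ t, N ≤ t → (W.st t).shade = (s : ℕ∞) ∧ ((p ^ e : ℕ) : ℕ∞) < ordZero (W.st t).F) →
    (∀ M : ℕ, ∃ i, M ≤ i ∧ W.b i ≠ 0) → (∃ M : ℕ, ∀ t, M ≤ t → LeavesNewest W t) →
    (¬ ∃ M : ℕ, ∃ i : Fin 3, ∃ a : ℕ, N ≤ M ∧ IsRigidHighFloorFrom W s M i a) → False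

/-- PIECE · THE LOCATED FREE RESIDUAL: RIGID FREE HIGH FLOORS — eventually newest-free high plateaux in LAW B's
normal form (profile boxes: `kept = (q−s)·e_i`, `o = q + a`, `1 ≤ a ≤ s−1`, hugging `E_i`).  WEAKER by letter
(`rigidFree_of_freeHigh`); DECIDED-MOD-PORT ⟸ arc law (`rigidFree_of_freeTails`); UNDECIDED in-model (IDEA-NEEDED:
in-model termination of rigid high floors = the port-free upgrade; INSTRUMENTABLE: T-high beds with the LAW B shape
field). -/
def NoRigidFreeHighFloorsDeep : Prop :=
  ∀ p : ℕ, p.Prime → ∀ e : ℕ, 2 ≤ e → ∀ (K : Type) [Field K] [CharP K p] [PerfectField K] [DecidableEq K]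
    (s₀ : State (Fin 3) K), IsRoot (p ^ e) s₀ → ∀ W : ForcedWalk (p ^ e) s₀,
    ∀ N s : ℕ, 2 ≤ s → s < p ^ e →
    (∀ t, N ≤ t → (W.st t).shade = (s : ℕ∞) ∧ ((p ^ e : ℕ) : ℕ∞) < ordZero (W.st t).F) →
    (∀ M : ℕ, ∃ i, M ≤ i ∧ W.b i ≠ 0) → (∃ M : ℕ, ∀ t, M ≤ t → LeavesNewest W t) →
    ∀ M : ℕ, ∀ i : Fin 3, ∀ a : ℕ, N ≤ M → IsRigidHighFloorFrom W s M i a → False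

/-- Necessity of the drifting cell (by letter). [folklore] -/
theorem drifting_of_freeHigh (h : NoFreeHighPlateauxDeepTwo) : NoDriftingFreeHighPlateauxDeep :=
  fun p hp e he K _ _ _ _ s₀ hs W N s h2 hsq hplat htr hfree _ => h p hp e he K s₀ hs W N s h2 hsq hplat htr hfree

/-- Necessity of the rigid cell (by letter). [folklore] -/
theorem rigidFree_of_freeHigh (h : NoFreeHighPlateauxDeepTwo) : NoRigidFreeHighFloorsDeep :=
  fun p hp e he K _ _ _ _ s₀ hs W N s h2 hsq hplat htr hfree _ _ _ _ _ => h p hp e he K s₀ hs W N s h2 hsq hplat htr hfree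

/-- **DECIDED (LAW B): drifting free high plateaux do not exist.** [new] [folklore] -/
theorem noDriftingFreeHigh_holds : NoDriftingFreeHighPlateauxDeep := by
  intro p hp e he K _ _ _ _ s₀ hs W N s h2 hsq hplat htr hfree hdrift
  obtain ⟨M₀, hM₀⟩ := hfree
  obtain ⟨M, i, a, hM, h1, h2a, hrig⟩ := free_high_rigid hs W hsq (N := max N M₀)
    (fun t ht => hplat t (le_of_max_le_left ht)) (fun t ht => hM₀ t (le_of_max_le_right ht)) htr
  exact hdrift ⟨M, i, a, le_of_max_le_left hM, h1, h2a, hrig⟩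

/-- The free half split EXACTLY into drifting ∧ rigid. [folklore] -/
theorem freeHigh_iff_drifting_rigid :
    NoFreeHighPlateauxDeepTwo ↔ NoDriftingFreeHighPlateauxDeep ∧ NoRigidFreeHighFloorsDeep := by
  refine ⟨fun h => ⟨drifting_of_freeHigh h, rigidFree_of_freeHigh h⟩, ?_⟩
  rintro ⟨hD, hR⟩ p hp e he K _ _ _ _ s₀ hs W N s h2 hsq hplat htr hfree
  by_cases hrig : ∃ M : ℕ, ∃ i : Fin 3, ∃ a : ℕ, N ≤ M ∧ IsRigidHighFloorFrom W s M i a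
  · obtain ⟨M, i, a, hM, hR'⟩ := hrig
    exact hR p hp e he K s₀ hs W N s h2 hsq hplat htr hfree M i a hM hR'
  · exact hD p hp e he K s₀ hs W N s h2 hsq hplat htr hfree hrig

/-- **The free half IS the rigid-floor cell (PROVED translation by LAW B).** [new] [folklore] -/
theorem freeHigh_iff_rigid : NoFreeHighPlateauxDeepTwo ↔ NoRigidFreeHighFloorsDeep :=
  ⟨rigidFree_of_freeHigh, fun h => freeHigh_iff_drifting_rigid.mpr ⟨noDriftingFreeHigh_holds, h⟩⟩

/-- The free half ⟸ the deep arc law (CONVERGENT with lens-5 g15 `noExcess_of_freeTails_repeat`; positivity of all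
shades from the eventual plateau by the tree's no-jump law, g14 `hpos_of_plateau`). [folklore] -/
theorem freeHigh_of_freeTails (hA : NoFreePointTailsDeep) : NoFreeHighPlateauxDeepTwo := by
  intro p hp e he K _ _ _ _ s₀ hs W N s h2 hsq hplat htr hfree
  obtain ⟨M, hM⟩ := hfree
  exact hA p hp e he K s₀ hs W
    (hpos_of_plateau shadeNeverIncreases_holds hp (one_le_two.trans he) hs W (fun t ht => (hplat t ht).1) (by omega))
    M hM

/-- The rigid-floor cell ⟸ the deep arc law (DECIDED-MOD-PORT booking). [folklore] -/
theorem rigidFree_of_freeTails (hA : NoFreePointTailsDeep) : NoRigidFreeHighFloorsDeep :=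
  rigidFree_of_freeHigh (freeHigh_of_freeTails hA)

/-! ### §D.4 The repeat half: the POWER LAW decides the binary sub-cell; the residue is CONE-LINE REPEATS -/

/-- PIECE · BINARY REPEATS — high plateaux with infinitely many proximity repeats whose residual form is NOT the
`s`-fold line through the next centre.  WEAKER by letter (`binaryRepeat_of_repeatHigh`); **DECIDED: EMPTY**
(`noBinaryRepeatHigh_holds`, POWER LAW). -/
def NoBinaryRepeatHighPlateauxDeep : Prop :=
  ∀ p : ℕ, p.Prime → ∀ e : ℕ, 2 ≤ e → ∀ (K : Type) [Field K] [CharP K p] [PerfectField K] [DecidableEq K]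
    (s₀ : State (Fin 3) K), IsRoot (p ^ e) s₀ → ∀ W : ForcedWalk (p ^ e) s₀,
    ∀ N s : ℕ, 2 ≤ s → s < p ^ e →
    (∀ t, N ≤ t → (W.st t).shade = (s : ℕ∞) ∧ ((p ^ e : ℕ) : ℕ∞) < ordZero (W.st t).F) →
    (∀ M : ℕ, ∃ i, M ≤ i ∧ W.b i ≠ 0) →
    (∀ M : ℕ, ∃ t o : ℕ, M ≤ t ∧ ordZero (W.st t).F = (o : ℕ∞) ∧ StaysOnNewest W t ∧ ¬ IsConeLine W t o s) →
    False

/-- PIECE · THE RE-LOCATED RESIDUAL: CONE-LINE REPEAT-RECURRENT HIGH PLATEAUX — high subcritical plateaux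
(`2 ≤ s ≤ q−1`, `o_t > q`, translations i.o.) with proximity repeats i.o., every late repeat a CONE-LINE repeat
(`N_t = c·(u_k − b_{t+1}(k)·u_{j_{t+1}})^s`).  WEAKER by letter (`coneLine_of_repeatHigh`); EQUIVALENT to the repeat
half by the power law (`repeatHigh_iff_coneLine`); UNDECIDED (test: T-excess-0 EMPTY at depth 10 on the root beds,
T-high-1 0 alive at depth 14 on 2 819 seeded high roots, T-plateau-1: every repeat plateau dies within ≤ 4 moves);
IDEA-NEEDED (SEED-g16: transport of the cone line through the repeat by the restriction identity (B) + the exit-depth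
of an `s`-fold line; maximal contact `u_k − β u_i` when `p ∤ s`). -/
def NoConeLineRepeatHighPlateauxDeep : Prop :=
  ∀ p : ℕ, p.Prime → ∀ e : ℕ, 2 ≤ e → ∀ (K : Type) [Field K] [CharP K p] [PerfectField K] [DecidableEq K]
    (s₀ : State (Fin 3) K), IsRoot (p ^ e) s₀ → ∀ W : ForcedWalk (p ^ e) s₀,
    ∀ N s : ℕ, 2 ≤ s → s < p ^ e →
    (∀ t, N ≤ t → (W.st t).shade = (s : ℕ∞) ∧ ((p ^ e : ℕ) : ℕ∞) < ordZero (W.st t).F) →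
    (∀ M : ℕ, ∃ i, M ≤ i ∧ W.b i ≠ 0) → (∀ M : ℕ, ∃ t, M ≤ t ∧ StaysOnNewest W t) →
    (∃ N' : ℕ, ∀ t, N' ≤ t → StaysOnNewest W t → ∀ o : ℕ, ordZero (W.st t).F = (o : ℕ∞) → IsConeLine W t o s) →
    False

/-- Necessity of the binary cell (by letter: binary repeats i.o. are repeats i.o.). [folklore] -/
theorem binaryRepeat_of_repeatHigh (h : NoRepeatHighPlateauxDeepTwo) : NoBinaryRepeatHighPlateauxDeep := by
  intro p hp e he K _ _ _ _ s₀ hs W N s h2 hsq hplat htr hbin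
  refine h p hp e he K s₀ hs W N s h2 hsq hplat htr fun M => ?_
  obtain ⟨t, o, ht, -, hS, -⟩ := hbin M
  exact ⟨t, ht, hS⟩

/-- Necessity of the cone-line residual (by letter). [folklore] -/
theorem coneLine_of_repeatHigh (h : NoRepeatHighPlateauxDeepTwo) : NoConeLineRepeatHighPlateauxDeep :=
  fun p hp e he K _ _ _ _ s₀ hs W N s h2 hsq hplat htr hrep _ => h p hp e he K s₀ hs W N s h2 hsq hplat htr hrep

/-- **DECIDED (POWER LAW): binary repeats do not exist on high plateaux.** [new] [folklore] -/
theorem noBinaryRepeatHigh_holds : NoBinaryRepeatHighPlateauxDeep := by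
  intro p hp e he K _ _ _ _ s₀ hs W N s h2 hsq hplat htr hbin
  obtain ⟨t, o, ht, ho, hS, hnot⟩ := hbin N
  exact hnot (isConeLine_of_plateau hs W hplat ht hS ho)

/-- The repeat half split EXACTLY into binary ∧ cone-line. [folklore] -/
theorem repeatHigh_iff_binary_coneLine :
    NoRepeatHighPlateauxDeepTwo ↔ NoBinaryRepeatHighPlateauxDeep ∧ NoConeLineRepeatHighPlateauxDeep := by
  refine ⟨fun h => ⟨binaryRepeat_of_repeatHigh h, coneLine_of_repeatHigh h⟩, ?_⟩
  rintro ⟨hB, hC⟩ p hp e he K _ _ _ _ s₀ hs W N s h2 hsq hplat htr hrep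
  by_cases hall : ∃ N' : ℕ, ∀ t, N' ≤ t → StaysOnNewest W t → ∀ o : ℕ, ordZero (W.st t).F = (o : ℕ∞) →
      IsConeLine W t o s
  · exact hC p hp e he K s₀ hs W N s h2 hsq hplat htr hrep hall
  · push Not at hall
    refine hB p hp e he K s₀ hs W N s h2 hsq hplat htr fun M => ?_
    obtain ⟨t, ht, hS, o, ho, hnot⟩ := hall M
    exact ⟨t, o, ht, ho, hS, hnot⟩

/-- **THE POWER-LAW TRANSLATION of the repeat half (PROVED): repeat-recurrent high plateaux ARE cone-line
repeat-recurrent high plateaux.** [new] [folklore] -/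
theorem repeatHigh_iff_coneLine : NoRepeatHighPlateauxDeepTwo ↔ NoConeLineRepeatHighPlateauxDeep :=
  ⟨coneLine_of_repeatHigh, fun h => repeatHigh_iff_binary_coneLine.mpr ⟨noBinaryRepeatHigh_holds, h⟩⟩

/-! ### §D.4b The DOUBLE-REPEAT LAW decides one more sub-cell of the repeat half (g15 rev 1) -/

/-- PIECE · ORIGIN SWITCHING DOUBLE REPEATS — high plateaux with infinitely many double repeats `S S` whose second repeat
switches to the third chart (`j_{t+2} ≠ j_t`) with its centre still ON the old component (`b_{t+2}(j_t) = 0`).  WEAKER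
by letter (`originSwitch_of_repeatHigh`); **DECIDED: EMPTY** (`noOriginSwitchDoubleRepeats_holds`, DOUBLE-REPEAT LAW);
an explicit new transition rule for g14's ledger automaton. -/
def NoOriginSwitchDoubleRepeatsDeep : Prop :=
  ∀ p : ℕ, p.Prime → ∀ e : ℕ, 2 ≤ e → ∀ (K : Type) [Field K] [CharP K p] [PerfectField K] [DecidableEq K]
    (s₀ : State (Fin 3) K), IsRoot (p ^ e) s₀ → ∀ W : ForcedWalk (p ^ e) s₀,
    ∀ N s : ℕ, 2 ≤ s → s < p ^ e →
    (∀ t, N ≤ t → (W.st t).shade = (s : ℕ∞) ∧ ((p ^ e : ℕ) : ℕ∞) < ordZero (W.st t).F) →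
    (∀ M : ℕ, ∃ i, M ≤ i ∧ W.b i ≠ 0) →
    (∀ M : ℕ, ∃ t, M ≤ t ∧ StaysOnNewest W t ∧ StaysOnNewest W (t + 1) ∧ W.j (t + 2) ≠ W.j t ∧
      W.b (t + 2) (W.j t) = 0) → False

/-- Necessity of the origin-switch cell (by letter: its times are repeats). [folklore] -/
theorem originSwitch_of_repeatHigh (h : NoRepeatHighPlateauxDeepTwo) : NoOriginSwitchDoubleRepeatsDeep := by
  intro p hp e he K _ _ _ _ s₀ hs W N s h2 hsq hplat htr hdbl
  refine h p hp e he K s₀ hs W N s h2 hsq hplat htr fun M => ?_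
  obtain ⟨t, ht, hS, -⟩ := hdbl M
  exact ⟨t, ht, hS⟩

/-- **DECIDED (DOUBLE-REPEAT LAW): origin switching double repeats do not exist on high plateaux.** [new] [folklore] -/
theorem noOriginSwitchDoubleRepeats_holds : NoOriginSwitchDoubleRepeatsDeep := by
  intro p hp e he K _ _ _ _ s₀ hs W N s h2 hsq hplat htr hdbl
  obtain ⟨t, ht, hS, hS', hk, hβ⟩ := hdbl N
  exact translated_of_double_repeat_plateau hs W (by omega) hplat ht hS hS' hk hβ

open Summit.ResolutionOfSingularities.ResolutionOfSingularities.Theses in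
/-- Necessity of the origin-switch cell from 31770, BY NAME (unconditional). [folklore] -/
theorem originSwitch_of_defectWalksDeep (h : MaxContactCut.DefectWalksDeep) : NoOriginSwitchDoubleRepeatsDeep :=
  originSwitch_of_repeatHigh (repeatHigh_of_highTwo (highTwo_of_defectWalksDeep h))

/-! ### §D.4c LAW C books the ZIGZAG core of the repeat half (g15 rev 2) -/

/-- PIECE · ZIGZAG TAILS — high plateaux (translations i.o.) whose moves are eventually a pure ZIGZAG of proximity
repeats (`IsZigzagFrom W M`: charts alternate, every centre on the intersection of the two newest components).  WEAKER
by letter (`zigzag_of_repeatHigh`); UNDECIDED for `2s > q`, where LAW C (`zigzag_rigid`) gives the rigid profile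
`o = 2q − s`, `r = (q − s)(e_a + e_c)`; the core of the cone-line residual after the double-repeat law. -/
def NoZigzagTailsDeep : Prop :=
  ∀ p : ℕ, p.Prime → ∀ e : ℕ, 2 ≤ e → ∀ (K : Type) [Field K] [CharP K p] [PerfectField K] [DecidableEq K]
    (s₀ : State (Fin 3) K), IsRoot (p ^ e) s₀ → ∀ W : ForcedWalk (p ^ e) s₀,
    ∀ N s : ℕ, 2 ≤ s → s < p ^ e →
    (∀ t, N ≤ t → (W.st t).shade = (s : ℕ∞) ∧ ((p ^ e : ℕ) : ℕ∞) < ordZero (W.st t).F) →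
    (∀ M : ℕ, ∃ i, M ≤ i ∧ W.b i ≠ 0) →
    (∃ M, N ≤ M ∧ IsZigzagFrom W M) → False

/-- PIECE · LOW ZIGZAG TAILS — the zigzag tails of shade `s ≤ q/2`.  WEAKER by letter; **DECIDED: EMPTY**
(`noLowZigzagTails_holds`, LAW C + child isolation). -/
def NoLowZigzagTailsDeep : Prop :=
  ∀ p : ℕ, p.Prime → ∀ e : ℕ, 2 ≤ e → ∀ (K : Type) [Field K] [CharP K p] [PerfectField K] [DecidableEq K]
    (s₀ : State (Fin 3) K), IsRoot (p ^ e) s₀ → ∀ W : ForcedWalk (p ^ e) s₀,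
    ∀ N s : ℕ, 2 ≤ s → s < p ^ e →
    (∀ t, N ≤ t → (W.st t).shade = (s : ℕ∞) ∧ ((p ^ e : ℕ) : ℕ∞) < ordZero (W.st t).F) →
    (∀ M : ℕ, ∃ i, M ≤ i ∧ W.b i ≠ 0) →
    2 * s ≤ p ^ e → (∃ M, N ≤ M ∧ IsZigzagFrom W M) → False

/-- Necessity of the zigzag cell (by letter: a zigzag tail repeats i.o.). [folklore] -/
theorem zigzag_of_repeatHigh (h : NoRepeatHighPlateauxDeepTwo) : NoZigzagTailsDeep := by
  intro p hp e he K _ _ _ _ s₀ hs W N s h2 hsq hplat htr hz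
  obtain ⟨M, -, hM⟩ := hz
  refine h p hp e he K s₀ hs W N s h2 hsq hplat htr fun M₀ => ?_
  exact ⟨max M₀ M, le_max_left _ _, (hM (max M₀ M) (le_max_right _ _)).1⟩

/-- The low cell is the zigzag cell restricted. [folklore] -/
theorem lowZigzag_of_zigzag (h : NoZigzagTailsDeep) : NoLowZigzagTailsDeep :=
  fun p hp e he K _ _ _ _ s₀ hs W N s h2 hsq hplat htr _ hz => h p hp e he K s₀ hs W N s h2 hsq hplat htr hz

/-- **DECIDED (LAW C): zigzag tails of shade `s ≤ q/2` do not exist.** [new] [folklore] -/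
theorem noLowZigzagTails_holds : NoLowZigzagTailsDeep := by
  intro p hp e he K _ _ _ _ s₀ hs W N s h2 hsq hplat htr hlow hz
  obtain ⟨M, hNM, hM⟩ := hz
  have hlt := lt_two_mul_shade_of_zigzag hs W hsq hplat htr hNM hM
  omega

/-- **LAW C as a profile of the zigzag cell (PROVED)**: a counterexample to `NoZigzagTailsDeep` has `2s > q` and,
late, constant order `2q − s` with boundary `(q − s)(e_{j_v} + e_{j_{v+1}})`. [new] [folklore] -/
theorem zigzag_profile {p e : ℕ} {K : Type} [Field K] [DecidableEq K] {s₀ : State (Fin 3) K}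
    (hs : IsRoot (p ^ e) s₀) (W : ForcedWalk (p ^ e) s₀) {N s M : ℕ} (hsq : s < p ^ e)
    (hplat : ∀ t, N ≤ t → (W.st t).shade = (s : ℕ∞) ∧ ((p ^ e : ℕ) : ℕ∞) < ordZero (W.st t).F)
    (htr : ∀ M₀ : ℕ, ∃ i, M₀ ≤ i ∧ W.b i ≠ 0) (hNM : N ≤ M) (hz : IsZigzagFrom W M) :
    p ^ e < 2 * s ∧ ∃ M', M ≤ M' ∧ ∀ v, M' ≤ v → ordZero (W.st v).F = ((2 * p ^ e - s : ℕ) : ℕ∞) ∧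
      (W.st (v + 1)).r = Finsupp.single (W.j v) (p ^ e - s) + Finsupp.single (W.j (v + 1)) (p ^ e - s) :=
  ⟨lt_two_mul_shade_of_zigzag hs W hsq hplat htr hNM hz, zigzag_rigid hs W hsq hplat htr hNM hz⟩

open Summit.ResolutionOfSingularities.ResolutionOfSingularities.Theses in
/-- Necessity of the zigzag cells from 31770, BY NAME (unconditional). [folklore] -/
theorem zigzag_of_defectWalksDeep (h : MaxContactCut.DefectWalksDeep) : NoZigzagTailsDeep :=
  zigzag_of_repeatHigh (repeatHigh_of_highTwo (highTwo_of_defectWalksDeep h))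

/-! ### §D.4d LAW C⁺ books the whole EVENTUALLY-ALL-REPEAT regime; the repeat half splits EXACTLY into a RIGID
all-repeat core and the MIXED words (g15 rev 3) -/

/-- PIECE · ALL-REPEAT TAILS — high plateaux (translations i.o.) whose moves are EVENTUALLY ALL proximity repeats.
WEAKER by letter (`allRepeat_of_repeatHigh`); ≡ its rigid core `NoRigidAllRepeatTailsDeep` by LAW C⁺
(`allRepeat_iff_rigid`). -/
def NoAllRepeatTailsDeep : Prop :=
  ∀ p : ℕ, p.Prime → ∀ e : ℕ, 2 ≤ e → ∀ (K : Type) [Field K] [CharP K p] [PerfectField K] [DecidableEq K]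
    (s₀ : State (Fin 3) K), IsRoot (p ^ e) s₀ → ∀ W : ForcedWalk (p ^ e) s₀,
    ∀ N s : ℕ, 2 ≤ s → s < p ^ e →
    (∀ t, N ≤ t → (W.st t).shade = (s : ℕ∞) ∧ ((p ^ e : ℕ) : ℕ∞) < ordZero (W.st t).F) →
    (∀ M : ℕ, ∃ i, M ≤ i ∧ W.b i ≠ 0) →
    (∃ M, N ≤ M ∧ ∀ t, M ≤ t → StaysOnNewest W t) → False

/-- PIECE · LOW ALL-REPEAT TAILS (`s ≤ q/2`).  WEAKER by letter; **DECIDED: EMPTY** (`noLowAllRepeatTails_holds`). -/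
def NoLowAllRepeatTailsDeep : Prop :=
  ∀ p : ℕ, p.Prime → ∀ e : ℕ, 2 ≤ e → ∀ (K : Type) [Field K] [CharP K p] [PerfectField K] [DecidableEq K]
    (s₀ : State (Fin 3) K), IsRoot (p ^ e) s₀ → ∀ W : ForcedWalk (p ^ e) s₀,
    ∀ N s : ℕ, 2 ≤ s → s < p ^ e →
    (∀ t, N ≤ t → (W.st t).shade = (s : ℕ∞) ∧ ((p ^ e : ℕ) : ℕ∞) < ordZero (W.st t).F) →
    (∀ M : ℕ, ∃ i, M ≤ i ∧ W.b i ≠ 0) →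
    2 * s ≤ p ^ e → (∃ M, N ≤ M ∧ ∀ t, M ≤ t → StaysOnNewest W t) → False

/-- PIECE · RIGID ALL-REPEAT TAILS (the LOCATED all-repeat core) — shade `s > q/2`, all moves repeats, constant order
`2q − s`, two hugged components of mass `q − s` each, translations i.o.  UNDECIDED (SEED §1⁺⁺ (M3)); by LAW C⁺ this
is ALL of the all-repeat regime (`allRepeat_iff_rigid`). -/
def NoRigidAllRepeatTailsDeep : Prop :=
  ∀ p : ℕ, p.Prime → ∀ e : ℕ, 2 ≤ e → ∀ (K : Type) [Field K] [CharP K p] [PerfectField K] [DecidableEq K]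
    (s₀ : State (Fin 3) K), IsRoot (p ^ e) s₀ → ∀ W : ForcedWalk (p ^ e) s₀,
    ∀ N s : ℕ, 2 ≤ s → s < p ^ e →
    (∀ t, N ≤ t → (W.st t).shade = (s : ℕ∞) ∧ ((p ^ e : ℕ) : ℕ∞) < ordZero (W.st t).F) →
    (∀ M : ℕ, ∃ i, M ≤ i ∧ W.b i ≠ 0) →
    p ^ e < 2 * s → (∃ M, N ≤ M ∧ IsRigidRepeatTailFrom W s M) → False

/-- Necessity of the all-repeat cell (by letter). [folklore] -/
theorem allRepeat_of_repeatHigh (h : NoRepeatHighPlateauxDeepTwo) : NoAllRepeatTailsDeep := by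
  intro p hp e he K _ _ _ _ s₀ hs W N s h2 hsq hplat htr hall
  obtain ⟨M, -, hM⟩ := hall
  exact h p hp e he K s₀ hs W N s h2 hsq hplat htr fun M₀ => ⟨max M₀ M, le_max_left _ _, hM _ (le_max_right _ _)⟩

end Summit.ResolutionOfSingularities.ResolutionOfSingularities.Theorems.ConeCut
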